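import Summits.Ventures.Crystal3D.Theorems.StickyWulffConstantCoaxialWallLawTerracePropagation
import Summits.Ventures.Crystal3D.Theorems.StickyWulffConstantTextureLiminfTexShadowLevelLedgerEvents
import HarnessLib

/-!
# The terrace edge: an in-plane line never continues from the grain side into the twin's interior — a full ball or a twin-reading ball of
# `(A, n)` has no in-plane neighbour that is FULL in the twin frame (lane T (β) level ledger / lane F terraces; stmt-Ventures-23912; 19480-p1 g19)

HONEST FRAMING. Venture `Summits/Ventures/Crystal3D` (cell `crystal3d-full`), route `route-Ventures-StickyWulffConstant`, helper `--supports` the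
law-v5 crux `TextureLiminfV5` (stmt-Ventures-23912), lane T, line `TexShadow` v8.20, registered stub `stub_terraceCensus` (mechanism (β), LEDGER /
EVENT currency: …TexShadowLevelLedgerEvents p734210, …LevelLedgerEventsStar p734592; resume record HOME/wall-p1-g19/BETA-LEDGER-RESUME-g19.md §3(b)).
Pure metric geometry of the slot dozen and its twin; no certificate; nothing about energies; F-C1 not moved.

THE POINT.  In a coset-coherent (3-step) riser of a terraced twin surface the composition layer's SITES continue into the twin lamella, so one may
fear that a line gliding along a terrace walks on coherently as a line of FULL balls of the twin frame `A′ x = A x − 2⟪A x, n⟫ n` — a free passage.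
It cannot: if `p` carries the lower polar cap `p + A w` (`⟪A w, n⟫ = −√(2/3)`) adjacent to an in-plane slot `h` (`⟪w, h⟫ = ½`) — as every `A`-full
ball and every twin-reading ball of `(A, n)` does — and its in-plane neighbour `p + A h` were full in the twin frame `A′`, then the twin-frame lower cap
`(p + A h) + A′(−w)` would lie at distance `1/√3` from `p + A w` (`lowerCaps_dist_sq`): two distinct balls closer than `1`.  Hence
* `not_isFull_twinFrame_of_lowerCap` — the core statement (one occupied lower cap adjacent to the step suffices);
* **`not_isFull_twinFrame_of_isFull_inPlane`** — an `A`-full ball has no `A′`-full in-plane neighbour;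
* **`not_isFull_twinFrame_of_twinReading_inPlane`** — a twin-reading ball of `(A, n)` (lane F's `IsTwinReading`) has no `A′`-full in-plane neighbour:
  a GLIDE RUN ENDS at the terrace edge (in lane F's automaton: the state after the last glide is not moving; in event currency: the first
  `A′`-line launched there has its event at once) — the «coincidence third» does not let composition-layer lines through;
* `exists_lowerCap_adjacent` — for a menu normal `n` and an in-plane slot `h` there is a lower polar slot `w` with `⟪w, h⟫ = ½` (from
  `exists_far_frame` / `inPlane_slot_eq_sub_far`, …CoaxialWallLawTerracePropagation).
WHAT THIS IS NOT: any count; the companion fact «no `A`-full ball beside a terrace ball» is `not_fullShell_of_twinDozen_inPlane` (ibid.); F-C1 not moved.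
-/

noncomputable section

open scoped InnerProductSpace

namespace Summit.Ventures.Crystal3D.Cruxes.TextureLiminf.TexShadow

open Finset Summit.Ventures.Crystal3D Summit.Ventures.Crystal3D.Theorems

/-! ## The metric core -/

/-- **The two lower caps across an in-plane step are `1/√3` apart.**  `‖n‖ = 1`, `h, w` slots with `⟪A h, n⟫ = 0`, `⟪A w, n⟫ = −√(2/3)`,
`⟪w, h⟫ = ½`; then `dist (p + A w) (p + A h + (A(−w) − 2⟪A(−w), n⟫ n))² = 1/3`. -/
theorem lowerCaps_dist_sq (A : EuclideanSpace ℝ (Fin 3) ≃ₗᵢ[ℝ] EuclideanSpace ℝ (Fin 3)) {n h w : EuclideanSpace ℝ (Fin 3)} (hn : ‖n‖ = 1)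
    (hh : h ∈ fccSlots) (hw : w ∈ fccSlots) (hhn : ⟪A h, n⟫_ℝ = 0) (hwn : ⟪A w, n⟫_ℝ = -Real.sqrt (2 / 3)) (hwh : ⟪w, h⟫_ℝ = 1 / 2)
    (p : EuclideanSpace ℝ (Fin 3)) :
    dist (p + A w) (p + A h + (A (-w) - (2 * ⟪A (-w), n⟫_ℝ) • n)) ^ 2 = 1 / 3 := by
  have hww : ⟪A w, A w⟫_ℝ = 1 := by
    rw [real_inner_self_eq_norm_sq, LinearIsometryEquiv.norm_map, norm_eq_one_of_mem_fccSlots hw, one_pow]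
  have hhh : ⟪A h, A h⟫_ℝ = 1 := by
    rw [real_inner_self_eq_norm_sq, LinearIsometryEquiv.norm_map, norm_eq_one_of_mem_fccSlots hh, one_pow]
  have hnn : ⟪n, n⟫_ℝ = 1 := by rw [real_inner_self_eq_norm_sq, hn, one_pow]
  have hwh' : ⟪A w, A h⟫_ℝ = 1 / 2 := by rw [LinearIsometryEquiv.inner_map_map, hwh]
  have hhw' : ⟪A h, A w⟫_ℝ = 1 / 2 := by rw [real_inner_comm, hwh']
  have hnh : ⟪n, A h⟫_ℝ = 0 := by rw [real_inner_comm, hhn]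
  have hnw : ⟪n, A w⟫_ℝ = -Real.sqrt (2 / 3) := by rw [real_inner_comm, hwn]
  have h23 : Real.sqrt (2 / 3) ^ 2 = 2 / 3 := Real.sq_sqrt (by norm_num)
  -- the difference vector is `2·A w − A h − 2⟪A w, n⟫ n`
  have e : p + A w - (p + A h + (A (-w) - (2 * ⟪A (-w), n⟫_ℝ) • n)) = (2 : ℝ) • A w - A h - (2 * ⟪A w, n⟫_ℝ) • n := by
    rw [map_neg, inner_neg_left]
    module
  rw [dist_eq_norm, e, ← real_inner_self_eq_norm_sq]
  simp only [inner_sub_left, inner_sub_right, real_inner_smul_left, real_inner_smul_right, hww, hhh, hnn, hwh', hhw', hhn, hnh,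
    hwn, hnw]
  nlinarith [h23]

/-- **No twin-full ball beside an occupied lower cap.**  `X` `1`-separated; `p + A w ∈ X` a lower polar cap adjacent to the in-plane step `h`;
then the in-plane neighbour `p + A h` is not full in the twin frame `A′` (`A′ x = A x − 2⟪A x, n⟫ n`). -/
theorem not_isFull_twinFrame_of_lowerCap {X : Finset (EuclideanSpace ℝ (Fin 3))} (hX : ∀ a ∈ X, ∀ b ∈ X, a ≠ b → 1 ≤ dist a b)
    (A A' : EuclideanSpace ℝ (Fin 3) ≃ₗᵢ[ℝ] EuclideanSpace ℝ (Fin 3)) {n h w : EuclideanSpace ℝ (Fin 3)} (hn : ‖n‖ = 1)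
    (hA' : ∀ x, A' x = A x - (2 * ⟪A x, n⟫_ℝ) • n)
    (hh : h ∈ fccSlots) (hw : w ∈ fccSlots) (hhn : ⟪A h, n⟫_ℝ = 0) (hwn : ⟪A w, n⟫_ℝ = -Real.sqrt (2 / 3)) (hwh : ⟪w, h⟫_ℝ = 1 / 2)
    {p : EuclideanSpace ℝ (Fin 3)} (hcap : p + A w ∈ X) (hfull : IsFull X A' (p + A h)) : False := by
  have hmem : p + A h + A' (-w) ∈ X := hfull (-w) (neg_mem_fccSlots hw)
  rw [hA'] at hmem
  have hsq := lowerCaps_dist_sq A hn hh hw hhn hwn hwh p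
  set q := p + A h + (A (-w) - (2 * ⟪A (-w), n⟫_ℝ) • n) with hq
  have hne : p + A w ≠ q := by
    intro heq
    rw [heq, dist_self] at hsq
    norm_num at hsq
  have hge := hX _ hcap _ hmem hne
  nlinarith [hge, hsq, dist_nonneg (x := p + A w) (y := q)]

/-! ## A lower cap adjacent to a given in-plane step exists -/

/-- For a menu normal `n` of `A` and an in-plane slot `h` there is a LOWER polar slot `w` (`⟪A w, n⟫ = −√(2/3)`) adjacent to `h` (`⟪w, h⟫ = ½`). -/
theorem exists_lowerCap_adjacent (A : EuclideanSpace ℝ (Fin 3) ≃ₗᵢ[ℝ] EuclideanSpace ℝ (Fin 3)) {n h : EuclideanSpace ℝ (Fin 3)}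
    (hmenu : IsMenuNormal A n) (hh : h ∈ fccSlots) (hhn : ⟪A h, n⟫_ℝ = 0) :
    ∃ w ∈ fccSlots, ⟪A w, n⟫_ℝ = -Real.sqrt (2 / 3) ∧ ⟪w, h⟫_ℝ = 1 / 2 := by
  -- the far frame of `−n` is the lower triple
  have hn' : ‖-n‖ = 1 := by rw [norm_neg, hmenu.1]
  have hmenu' : ∀ w ∈ fccSlots, ⟪A w, -n⟫_ℝ = 0 ∨ ⟪A w, -n⟫_ℝ = Real.sqrt (2 / 3) ∨ ⟪A w, -n⟫_ℝ = -Real.sqrt (2 / 3) := by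
    intro w hw
    rw [inner_neg_right]
    rcases hmenu.2 w hw with h0 | h0 | h0
    · exact Or.inl (by rw [h0, neg_zero])
    · exact Or.inr (Or.inr (by rw [h0]))
    · exact Or.inr (Or.inl (by rw [h0, neg_neg]))
  obtain ⟨u₁, hu₁, u₂, hu₂, u₃, hu₃, hn₁, hn₂, hn₃, i12, i13, i23, hind, -⟩ := exists_far_frame A hn' hmenu'
  have hh0 : ⟪A h, -n⟫_ℝ = 0 := by rw [inner_neg_right, hhn, neg_zero]
  have low : ∀ {u}, ⟪A u, -n⟫_ℝ = Real.sqrt (2 / 3) → ⟪A u, n⟫_ℝ = -Real.sqrt (2 / 3) := by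
    intro u hu; rw [inner_neg_right] at hu; linarith
  have h11 : ⟪u₁, u₁⟫_ℝ = 1 := by rw [real_inner_self_eq_norm_sq, norm_eq_one_of_mem_fccSlots hu₁, one_pow]
  have h22 : ⟪u₂, u₂⟫_ℝ = 1 := by rw [real_inner_self_eq_norm_sq, norm_eq_one_of_mem_fccSlots hu₂, one_pow]
  have h33 : ⟪u₃, u₃⟫_ℝ = 1 := by rw [real_inner_self_eq_norm_sq, norm_eq_one_of_mem_fccSlots hu₃, one_pow]
  have i21 : ⟪u₂, u₁⟫_ℝ = 1 / 2 := by rw [real_inner_comm]; exact i12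
  have i31 : ⟪u₃, u₁⟫_ℝ = 1 / 2 := by rw [real_inner_comm]; exact i13
  have i32 : ⟪u₃, u₂⟫_ℝ = 1 / 2 := by rw [real_inner_comm]; exact i23
  rcases inPlane_slot_eq_sub_far A hn' hu₁ hu₂ hu₃ hn₁ hn₂ hn₃ i12 i13 i23 hind hh hh0 with rfl | rfl | rfl | rfl | rfl | rfl
  · exact ⟨u₁, hu₁, low hn₁, by rw [inner_sub_right, h11, i12]; norm_num⟩
  · exact ⟨u₂, hu₂, low hn₂, by rw [inner_sub_right, h22, i21]; norm_num⟩
  · exact ⟨u₁, hu₁, low hn₁, by rw [inner_sub_right, h11, i13]; norm_num⟩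
  · exact ⟨u₃, hu₃, low hn₃, by rw [inner_sub_right, h33, i31]; norm_num⟩
  · exact ⟨u₂, hu₂, low hn₂, by rw [inner_sub_right, h22, i23]; norm_num⟩
  · exact ⟨u₃, hu₃, low hn₃, by rw [inner_sub_right, h33, i32]; norm_num⟩

/-! ## The two packaged statements -/

/-- **An `A`-full ball has no in-plane neighbour that is full in the twin frame** (for any menu normal `n` of `A` and in-plane slot `h`). -/
theorem not_isFull_twinFrame_of_isFull_inPlane {X : Finset (EuclideanSpace ℝ (Fin 3))} (hX : ∀ a ∈ X, ∀ b ∈ X, a ≠ b → 1 ≤ dist a b)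
    (A A' : EuclideanSpace ℝ (Fin 3) ≃ₗᵢ[ℝ] EuclideanSpace ℝ (Fin 3)) {n h : EuclideanSpace ℝ (Fin 3)} (hmenu : IsMenuNormal A n)
    (hA' : ∀ x, A' x = A x - (2 * ⟪A x, n⟫_ℝ) • n) (hh : h ∈ fccSlots) (hhn : ⟪A h, n⟫_ℝ = 0)
    {p : EuclideanSpace ℝ (Fin 3)} (hp : IsFull X A p) : ¬ IsFull X A' (p + A h) := by
  intro hfull
  obtain ⟨w, hw, hwn, hwh⟩ := exists_lowerCap_adjacent A hmenu hh hhn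
  exact not_isFull_twinFrame_of_lowerCap hX A A' hmenu.1 hA' hh hw hhn hwn hwh (hp w hw) hfull

/-- **A twin-reading ball of `(A, n)` has no in-plane neighbour that is full in the twin frame**: the glide run along a composition layer ENDS at the
terrace edge; the twin lamella's interior is never entered coherently by an in-plane line. -/
theorem not_isFull_twinFrame_of_twinReading_inPlane {X : Finset (EuclideanSpace ℝ (Fin 3))}
    (hX : ∀ a ∈ X, ∀ b ∈ X, a ≠ b → 1 ≤ dist a b)
    (A A' : EuclideanSpace ℝ (Fin 3) ≃ₗᵢ[ℝ] EuclideanSpace ℝ (Fin 3)) {n h q : EuclideanSpace ℝ (Fin 3)} (hq : IsTwinReading X A n q)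
    (hA' : ∀ x, A' x = A x - (2 * ⟪A x, n⟫_ℝ) • n) (hh : h ∈ fccSlots) (hhn : ⟪A h, n⟫_ℝ = 0) :
    ¬ IsFull X A' (q + A h) := by
  intro hfull
  obtain ⟨hmenu, hown, -, -⟩ := hq
  obtain ⟨w, hw, hwn, hwh⟩ := exists_lowerCap_adjacent A hmenu hh hhn
  have s23 : (0 : ℝ) < Real.sqrt (2 / 3) := Real.sqrt_pos.2 (by norm_num)
  exact not_isFull_twinFrame_of_lowerCap hX A A' hmenu.1 hA' hh hw hhn hwn hwh (hown w hw (by rw [hwn]; linarith)) hfull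

end Summit.Ventures.Crystal3D.Cruxes.TextureLiminf.TexShadow

end
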